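import Mathlib
import Summits.NavierStokesRegularity.NavierStokesRegularity.Theorems.EulerZoomLiouvillePowerGaugeEulerLiouvilleKelvinPhysical
import Literature.Analysis.FluidPDE.VorticityTransportFormulaProofs
import Literature.Analysis.FluidPDE.KelvinCirculationProofs
import Literature.Analysis.FluidPDE.SpaceTimeCalculus
import Literature.Analysis.FluidPDE.SpaceTimeCalculusC1
import HarnessLib

/-!
# Crux `EulerZoomLiouville.PowerGaugeEulerLiouville` (stmt-NavierStokesRegularity-19832), line `helicity-tube` rev4, stub T1′ — part 1:
# KELVIN'S IDENTITY AND THE CAUCHY FORMULA FOR A FLOW THAT IS A PARTICLE FLOW ONLY LOCALLY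

Route №10 `EulerZoomLiouville` (NavierStokesRegularity), crux E.  Line `helicity-tube` (ideator ns-idea-11 g4;
`Cruxes/PowerGaugeEulerLiouville/Lines/helicity_tube.lean` rev4 985d9ffb2a69), stub **T1 `stub_tubeTransport` in its GRADIENT-FREE text**.  The landed
T1-with-clause (`HelicityTube.tubesPersist_of_driftingPastWith`, ns-ezl-w5 g0, p628643) runs the GLOBAL particle flow of `u` and two GLOBAL tree
identities — the Lagrangian Cauchy formula `IsClassicalNSSolutionOn.curl_evolutionMap` and the torus-averaged Kelvin identity
`KelvinPhysical.integral_inner_evolutionMap_eq` — both stated for a map `X` with `∂ₜX(t,a) = u(t,X(t,a))` for EVERY label `a`.  Without the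
gradient clause only the CUTOFF-FIELD flow (`AnchoredBudget.…cutoffFlow…`, p631088) is global, and it is a `u`-flow only on the labels whose
trajectories stay in the plateau.  This file re-proves the two identities for an ABSTRACT jointly smooth two-time map `X` which is a
`u`-trajectory map only NEAR THE LABELS THAT MATTER (an open set of labels / the support of the test field):

* `hasDerivAt_velocity_comp_curve` — `d/dt u(t, γ t) = −∇p(t, γ t)` along ONE curve with `γ'(t) = u(t, γ t)` (Majda–Bertozzi (1.62));
* `kelvin_hasDerivAt_fderiv_flow_local` — `d/dt [D(X t)(y) w] = D(u t)(X t y)(D(X t)(y) w)` when `∂ₜX(t,·) = u(t,X(t,·))` holds for labels NEAR `y`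
  (Schwarz for the jointly smooth `X`, then `Filter.EventuallyEq.fderiv_eq`);
* `hasDerivAt_circulation_integrand_local` — the time derivative of `⟪u(t, X(t,y)), D(X t)(y) w⟫`, same locality;
* `curl_flow_eq_local` — **two-time CAUCHY FORMULA along such a flow**: `curl u(t, X(t,a)) = D(X t)(a) · curl u(t₀, a)` when `X t₀ = id` near… (globally
  `X t₀ = id`) and the trajectory property holds near `a` at every time of `[t₀,t]` (both sides solve `W' = ∇u(r, X(r,a)) W`; linear-ODE uniqueness,
  Mathlib `ODE_solution_unique_of_mem_Icc_right`);
* `integral_inner_flow_eq_local` — **KELVIN'S IDENTITY, torus-averaged, local form**: `∫ ⟪u(t, X(t,a)), D(X t)(a) B(a)⟫ da = ∫ ⟪u(t₀,a), B(a)⟫ da` for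
  `B ∈ C_c^∞` divergence-free, when the trajectory property holds near every label of `tsupport B` at every time of `[t₀,t]` (the proof of
  `KelvinPhysical.integral_inner_evolutionMap_eq` with the local integrand derivative).

WHAT THIS IS NOT: not NS, not the crux E — kinematics of classical Euler flows `--supports` stmt-19832 for ONE stub of ONE line; 19832 OPEN.
[cite: MajdaBertozziCUP2002, §1.6 Lemma 1.4, Props. 1.8, 1.10–1.11, eqs. (1.51), (1.58)–(1.62); §2.5 (2.115)–(2.117)]
-/

noncomputable section

-- flat `Theorems/<Route><Decl>…` files of one crux share the namespace of the crux (tree convention)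
set_option linter.dupNamespace false

open MeasureTheory Set Filter Topology Metric Function InnerProductSpace
open scoped RealInnerProductSpace NNReal ENNReal ContDiff

namespace Summit.NavierStokesRegularity.NavierStokesRegularity.Theorems.PowerGaugeEulerLiouville.HelicityTube

open Literature.Analysis Literature.Analysis.FluidPDE

variable {S : Set ℝ} {u : ℝ → EuclideanSpace ℝ (Fin 3) → EuclideanSpace ℝ (Fin 3)} {p : ℝ → EuclideanSpace ℝ (Fin 3) → ℝ}
  {X : ℝ → EuclideanSpace ℝ (Fin 3) → EuclideanSpace ℝ (Fin 3)}

/-! ### Pointwise calculus along one trajectory -/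

/-- **Material derivative of the velocity along ONE trajectory**: if `γ'(t) = u(t, γ t)` at an interior time `t` of `S`, then
`d/dt u(t, γ t) = (∂ₜu + (u·∇)u)(t, γ t) = −∇p(t, γ t)`. [cite: MajdaBertozziCUP2002, §1.6–1.7, eqs. (1.13), (1.62)] -/
theorem hasDerivAt_velocity_comp_curve (h : IsClassicalEulerSolutionOn S 0 u p) {γ : ℝ → EuclideanSpace ℝ (Fin 3)} {t : ℝ}
    (ht : S ∈ 𝓝 t) (hγ : HasDerivAt γ (u t (γ t)) t) :
    HasDerivAt (fun τ => u τ (γ τ)) (-gradient (p t) (γ t)) t := by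
  have htS : t ∈ interior S := mem_interior_iff_mem_nhds.2 ht
  have hu : IsSmoothSpaceTimeOn (interior S) u := h.smooth_velocity.mono interior_subset
  have hc : HasDerivAt (fun τ : ℝ => (τ, γ τ)) ((1 : ℝ), u t (γ t)) t := (hasDerivAt_id' t).prodMk hγ
  have hU : HasFDerivAt (uncurry u) (fderiv ℝ (uncurry u) (t, γ t)) (t, γ t) :=
    ((hu.contDiffAt isOpen_interior htS (γ t)).differentiableAt (by simp)).hasFDerivAt
  have h2 := hU.comp_hasDerivAt t hc
  rw [h.fderiv_uncurry_apply_one_velocity ht] at h2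
  exact h2

/-- **Time derivative of the stretching factor, local form**: if `X` is jointly smooth on `S × ℝ³` and `∂ₜX(t,a) = u(t, X(t,a))` for all labels `a`
NEAR `y` (at the interior time `t`), then `d/dt [D(X t)(y) w] = D(u t)(X t y) (D(X t)(y) w)`.
[cite: MajdaBertozziCUP2002, §1.6, proof of Lemma 1.4] -/
theorem kelvin_hasDerivAt_fderiv_flow_local (hu : IsSmoothSpaceTimeOn S u) (hX : IsSmoothSpaceTimeOn S X) {t : ℝ} (ht : S ∈ 𝓝 t)
    {y : EuclideanSpace ℝ (Fin 3)} (hXu : ∀ᶠ a in 𝓝 y, HasDerivAt (fun s => X s a) (u t (X t a)) t) (w : EuclideanSpace ℝ (Fin 3)) :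
    HasDerivAt (fun τ => fderiv ℝ (X τ) y w) (fderiv ℝ (u t) (X t y) (fderiv ℝ (X t) y w)) t := by
  have htS : t ∈ interior S := mem_interior_iff_mem_nhds.2 ht
  have htS' : t ∈ S := interior_subset htS
  have hX' : IsSmoothSpaceTimeOn (interior S) X := hX.mono interior_subset
  have h1 := hX'.hasDerivAt_fderiv_slice isOpen_interior htS y w
  have heq : (fun y' => deriv (fun s => X s y') t) =ᶠ[𝓝 y] (u t ∘ X t) := by
    filter_upwards [hXu] with y' hy'
    exact hy'.deriv
  rw [heq.fderiv_eq, fderiv_comp y ((hu.contDiff_slice htS').differentiable (by simp) _)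
    ((hX.contDiff_slice htS').differentiable (by simp) _)] at h1
  exact h1

/-- **The time derivative of the circulation integrand, local form**: at an interior time `t` of `S`, if `∂ₜX(t,a) = u(t,X(t,a))` for labels
near `y`, then `d/dt ⟪u(t, X(t,y)), D(X t)(y) w⟫ = ⟪u(t,Y), D(u t)(Y)(D(X t)(y) w)⟫ − D(p t)(Y)(D(X t)(y) w)`, `Y = X(t,y)`.
[cite: MajdaBertozziCUP2002, §1.6 Prop. 1.10–1.11, eqs. (1.58)–(1.59)] -/
theorem hasDerivAt_circulation_integrand_local (h : IsClassicalEulerSolutionOn S 0 u p) (hX : IsSmoothSpaceTimeOn S X) {t : ℝ}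
    (ht : S ∈ 𝓝 t) {y : EuclideanSpace ℝ (Fin 3)} (hXu : ∀ᶠ a in 𝓝 y, HasDerivAt (fun s => X s a) (u t (X t a)) t)
    (w : EuclideanSpace ℝ (Fin 3)) :
    HasDerivAt (fun τ => ⟪u τ (X τ y), fderiv ℝ (X τ) y w⟫)
      (⟪u t (X t y), fderiv ℝ (u t) (X t y) (fderiv ℝ (X t) y w)⟫ - fderiv ℝ (p t) (X t y) (fderiv ℝ (X t) y w)) t := by
  have hG := hasDerivAt_velocity_comp_curve h ht (γ := fun s => X s y) hXu.self_of_nhds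
  have hB := kelvin_hasDerivAt_fderiv_flow_local h.smooth_velocity hX ht hXu w
  refine (hG.inner ℝ hB).congr_deriv ?_
  rw [inner_neg_left, inner_gradient_left]
  ring

/-! ### The two-time Cauchy formula along a locally-particle flow -/

/-- **CAUCHY'S FORMULA along a flow that is a particle flow near one label.**  `S` open, `u` a classical Euler flow on `S`, `X` jointly smooth on
`S × ℝ³` with `X t₀ = id`; `t₀ ≤ t`, `[t₀,t] ⊆ S`; at every time `r ∈ [t₀,t]` the trajectory property `∂ₜX(r,a') = u(r, X(r,a'))` holds for all labels
`a'` near `a`.  Then `curl u(t, X(t,a)) = D(X t)(a) · curl u(t₀, a)`: both `r ↦ curl u(r, X(r,a))` (vorticity equation along the trajectory,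
`hasDerivWithinAt_curl_flow`) and `r ↦ D(X r)(a) curl u(t₀,a)` (the local variational equation) solve the linear ODE `W' = ∇u(r, X(r,a)) W` on
`[t₀,t]` with the same initial value. [cite: MajdaBertozziCUP2002, §1.6 Prop. 1.8 eq. (1.51); §2.5 (2.115)–(2.117)] -/
theorem curl_flow_eq_local (h : IsClassicalEulerSolutionOn S 0 u p) (hSo : IsOpen S) (hX : IsSmoothSpaceTimeOn S X)
    {t₀ t : ℝ} (ht₀t : t₀ ≤ t) (hI : Icc t₀ t ⊆ S) (hX0 : X t₀ = id) (a : EuclideanSpace ℝ (Fin 3))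
    (hXu : ∀ r ∈ Icc t₀ t, ∀ᶠ a' in 𝓝 a, HasDerivAt (fun s => X s a') (u r (X r a')) r) :
    curl (u t) (X t a) = fderiv ℝ (X t) a (curl (u t₀) a) := by
  rcases ht₀t.eq_or_lt with rfl | hlt
  · rw [hX0, fderiv_id]; rfl
  have hIU : UniqueDiffOn ℝ (Icc t₀ t) := uniqueDiffOn_Icc hlt
  have hI' : IsClassicalEulerSolutionOn (Icc t₀ t) 0 u p := h.mono hI hIU
  -- the coefficient `A r = ∇u(r, X r a)` is continuous on `[t₀,t]`
  set A : ℝ → EuclideanSpace ℝ (Fin 3) →L[ℝ] EuclideanSpace ℝ (Fin 3) := fun r => fderiv ℝ (u r) (X r a) with hA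
  have hγc : ContinuousOn (fun r => X r a) S := by
    have h2 : ContinuousOn (fun r : ℝ => ((r, a) : ℝ × EuclideanSpace ℝ (Fin 3))) S := continuousOn_id.prodMk continuousOn_const
    exact hX.continuousOn.comp h2 fun r hr => mk_mem_prod hr (mem_univ _)
  have hAc : ContinuousOn A (Icc t₀ t) := by
    have h1 := (h.smooth_velocity.fderiv_slice hSo.uniqueDiffOn).continuousOn
    have h2 : ContinuousOn (fun r : ℝ => ((r, X r a) : ℝ × EuclideanSpace ℝ (Fin 3))) (Icc t₀ t) :=
      continuousOn_id.prodMk (hγc.mono hI)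
    exact h1.comp h2 fun r hr => mk_mem_prod (hI hr) (mem_univ _)
  obtain ⟨C, hC⟩ := isCompact_Icc.exists_bound_of_continuousOn hAc
  set K : ℝ≥0 := ⟨max C 0, le_max_right _ _⟩ with hK
  have hlip : ∀ r ∈ Ico t₀ t, LipschitzOnWith K (fun W : EuclideanSpace ℝ (Fin 3) => A r W) univ := by
    intro r hr
    refine ((A r).lipschitz.weaken ?_).lipschitzOnWith
    have h1 : ‖A r‖ ≤ max C 0 := (hC r (Ico_subset_Icc_self hr)).trans (le_max_left _ _)
    exact_mod_cast h1
  -- solution 1: the vorticity along the trajectory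
  set W₁ : ℝ → EuclideanSpace ℝ (Fin 3) := fun r => curl (u r) (X r a) with hW₁
  have hW₁' : ∀ r ∈ Icc t₀ t, HasDerivWithinAt W₁ (A r (W₁ r)) (Icc t₀ t) r := fun r hr =>
    hI'.hasDerivWithinAt_curl_flow hIU (X := fun s (_ : EuclideanSpace ℝ (Fin 3)) => X s a)
      (fun r' hr' _ => ((hXu r' hr').self_of_nhds).hasDerivWithinAt) hr a
  -- solution 2: the transported initial vorticity
  set W₂ : ℝ → EuclideanSpace ℝ (Fin 3) := fun r => fderiv ℝ (X r) a (curl (u t₀) a) with hW₂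
  have hW₂' : ∀ r ∈ Icc t₀ t, HasDerivAt W₂ (A r (W₂ r)) r := fun r hr =>
    kelvin_hasDerivAt_fderiv_flow_local h.smooth_velocity hX (hSo.mem_nhds (hI hr)) (hXu r hr) _
  -- uniqueness on `[t₀, t]`
  have hnhds : ∀ r ∈ Ico t₀ t, Icc t₀ t ∈ 𝓝[Ici r] r := fun r hr =>
    mem_of_superset (Icc_mem_nhdsGE hr.2) (Icc_subset_Icc_left hr.1)
  have heq := ODE_solution_unique_of_mem_Icc_right hlip
    (fun r hr => (hW₁' r hr).continuousWithinAt)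
    (fun r hr => ((hW₁' r (Ico_subset_Icc_self hr)).mono_of_mem_nhdsWithin (hnhds r hr)))
    (fun _ _ => mem_univ _)
    (fun r hr => (hW₂' r hr).continuousAt.continuousWithinAt)
    (fun r hr => (hW₂' r (Ico_subset_Icc_self hr)).hasDerivWithinAt)
    (fun _ _ => mem_univ _)
    (by simp only [hW₁, hW₂, hX0, fderiv_id, id_eq, ContinuousLinearMap.coe_id'])
  exact heq (right_mem_Icc.2 ht₀t)

/-! ### Kelvin's identity, torus-averaged, for a locally-particle flow -/

/-- **KELVIN'S IDENTITY for a flow that is a particle flow near the support of the test field.**  `S` open, `u` a classical Euler flow on `S`,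
`X` jointly smooth on `S × ℝ³` with `X t₀ = id`, `t₀ ≤ t`, `[t₀,t] ⊆ S`, `B ∈ C_c^∞(ℝ³; ℝ³)` divergence-free, and at every time `r ∈ [t₀,t]` and
every label `a ∈ tsupport B` the trajectory property holds for labels near `a`.  Then `∫ ⟪u(t, X(t,a)), D(X t)(a) B(a)⟫ da = ∫ ⟪u(t₀,a), B(a)⟫ da`
(the time derivative of the left side is `∫ D[½|u|² − p](X(r,a))[D(X r)(a) B(a)] da = ∫ D(θ_r ∘ X r)(a)[B(a)] da = 0` by the divergence theorem
against the divergence-free `B`). [cite: MajdaBertozziCUP2002, §1.6 Props. 1.10–1.11, eqs. (1.58)–(1.59)] -/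
theorem integral_inner_flow_eq_local (h : IsClassicalEulerSolutionOn S 0 u p) (hSo : IsOpen S) (hX : IsSmoothSpaceTimeOn S X)
    {t₀ t : ℝ} (ht₀t : t₀ ≤ t) (hI : Icc t₀ t ⊆ S) (hX0 : X t₀ = id)
    {B : EuclideanSpace ℝ (Fin 3) → EuclideanSpace ℝ (Fin 3)} (hB : ContDiff ℝ ∞ B) (hBc : HasCompactSupport B)
    (hBdiv : VectorCalculus.IsDivFree B)
    (hXu : ∀ r ∈ Icc t₀ t, ∀ a ∈ tsupport B, ∀ᶠ a' in 𝓝 a, HasDerivAt (fun s => X s a') (u r (X r a')) r) :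
    ∫ a, ⟪u t (X t a), fderiv ℝ (X t) a (B a)⟫ = ∫ a, ⟪u t₀ a, B a⟫ := by
  have hU : UniqueDiffOn ℝ S := hSo.uniqueDiffOn
  -- the integrand `F(r, a) = ⟪u(r, X_r a), DX_r(a) B(a)⟫` is jointly smooth on `S × ℝ³`
  set F : ℝ → EuclideanSpace ℝ (Fin 3) → ℝ := fun r a => ⟪u r (X r a), fderiv ℝ (X r) a (B a)⟫ with hF
  have huX : IsSmoothSpaceTimeOn S (fun r a => u r (X r a)) := by
    have hΨ : ContDiffOn ℝ ∞ (fun z : ℝ × EuclideanSpace ℝ (Fin 3) => ((z.1, X z.1 z.2) : ℝ × _)) (S ×ˢ univ) :=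
      contDiffOn_fst.prodMk hX
    have hmaps : MapsTo (fun z : ℝ × EuclideanSpace ℝ (Fin 3) => ((z.1, X z.1 z.2) : ℝ × _))
        (S ×ˢ (univ : Set (EuclideanSpace ℝ (Fin 3)))) (S ×ˢ univ) := fun z hz => mk_mem_prod hz.1 (mem_univ _)
    exact h.smooth_velocity.comp hΨ hmaps
  have hBs : IsSmoothSpaceTimeOn S (fun _ : ℝ => B) := (hB.comp contDiff_snd).contDiffOn
  have hFs : IsSmoothSpaceTimeOn S F := huX.inner ((hX.fderiv_slice hU).clm_apply hBs)
  have hF1 : ContDiffOn ℝ 1 (uncurry F) (S ×ˢ univ) := hFs.of_le (mod_cast le_top)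
  have hsupp : ∀ r ∈ S, ∀ a ∉ tsupport B, F r a = 0 := by
    intro r _ a ha
    simp [hF, image_eq_zero_of_notMem_tsupport ha]
  -- the derivative of `r ↦ ∫ F r` vanishes on `[t₀, t]`
  have hderiv : ∀ r ∈ Icc t₀ t, HasDerivAt (fun r => ∫ a, F r a) 0 r := by
    intro r hr
    have hrS : r ∈ S := hI hr
    have hd := hasDerivAt_integral_of_contDiffOn (μ := volume) hSo hF1 hBc.isCompact hsupp hrS
    have hG1 : ContDiff ℝ 1 (fun z => (1 / 2 : ℝ) * ‖u r z‖ ^ 2 - p r z) :=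
      (((h.contDiff_velocity hrS).of_le (mod_cast le_top)).norm_sq ℝ |>.const_smul (1 / 2 : ℝ)).sub
        ((h.contDiff_pressure hrS).of_le (mod_cast le_top))
    have hline : ∀ a, deriv (fun r => F r a) r =
        fderiv ℝ (fun a => (1 / 2 : ℝ) * ‖u r (X r a)‖ ^ 2 - p r (X r a)) a (B a) := by
      intro a
      by_cases ha : a ∈ tsupport B
      · rw [(hasDerivAt_circulation_integrand_local h hX (hSo.mem_nhds hrS) (hXu r hr a ha) (B a)).deriv]
        have hc : (fun a => (1 / 2 : ℝ) * ‖u r (X r a)‖ ^ 2 - p r (X r a)) =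
            (fun z => (1 / 2 : ℝ) * ‖u r z‖ ^ 2 - p r z) ∘ X r := rfl
        rw [hc, fderiv_comp a ((hG1.differentiable one_ne_zero) _)
          (((hX.contDiff_slice hrS).differentiable (by simp)) a)]
        have hG : HasFDerivAt (fun z => (1 / 2 : ℝ) * ‖u r z‖ ^ 2 - p r z)
            ((1 / 2 : ℝ) • ((innerSL ℝ (u r (X r a))).comp (fderiv ℝ (u r) (X r a)) +
                (innerSL ℝ (u r (X r a))).comp (fderiv ℝ (u r) (X r a))) - fderiv ℝ (p r) (X r a))
            (X r a) := by
          have h1 := (((h.contDiff_velocity hrS).differentiable (by simp)) (X r a)).hasFDerivAt.norm_sq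
          rw [two_smul] at h1
          exact (h1.const_mul (1 / 2 : ℝ)).sub
            (((h.contDiff_pressure hrS).differentiable (by simp)) (X r a)).hasFDerivAt
        rw [ContinuousLinearMap.comp_apply, hG.fderiv]
        simp only [_root_.sub_apply, _root_.smul_apply, _root_.add_apply,
          ContinuousLinearMap.coe_comp, Function.comp_apply, innerSL_apply_apply, smul_eq_mul]
        ring
      · -- off the support both sides vanish
        have hB0 : B a = 0 := image_eq_zero_of_notMem_tsupport ha
        have hF0 : (fun r => F r a) = fun _ => 0 := by
          funext r'
          simp [hF, hB0]
        rw [hF0, deriv_const, hB0, map_zero]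
    simp_rw [hline] at hd
    have hθ : ContDiff ℝ 1 (fun a => (1 / 2 : ℝ) * ‖u r (X r a)‖ ^ 2 - p r (X r a)) :=
      hG1.comp ((hX.contDiff_slice hrS).of_le (mod_cast le_top))
    rwa [Kelvin.integral_fderiv_apply_eq_zero_of_isDivFree hθ (hB.of_le (mod_cast le_top)) hBc hBdiv] at hd
  -- hence `r ↦ ∫ F r` is constant on `[t₀, t]`
  have hconst : ∀ r ∈ Icc t₀ t, (∫ a, F r a) = ∫ a, F t₀ a := by
    intro r hr
    exact constant_of_has_deriv_right_zero (f := fun r => ∫ a, F r a) (a := t₀) (b := t)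
      (fun r hr => (hderiv r hr).continuousAt.continuousWithinAt)
      (fun r hr => (hderiv r (Ico_subset_Icc_self hr)).hasDerivWithinAt) r hr
  have h0 : (∫ a, F t₀ a) = ∫ a, ⟪u t₀ a, B a⟫ := by
    refine integral_congr_ae (Eventually.of_forall fun a => ?_)
    simp [hF, hX0, fderiv_id]
  rw [← h0, ← hconst t (right_mem_Icc.2 ht₀t)]

end Summit.NavierStokesRegularity.NavierStokesRegularity.Theorems.PowerGaugeEulerLiouville.HelicityTube

end
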